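import Literature.Combinatorics.Digraph.LineDigraphLaplacianSpectrum
import HarnessLib

/-!
# Weighted arborescences: the arc-weighted matrix-tree theorem for directed multigraphs and Levine's
# Theorem 1.1, `κ^{vertex}(LG, x) = κ^{edge}(G, x) · ∏_v (Σ_{s(e)=v} x_e)^{indeg(v) − 1}`

Topic `Literature/Combinatorics/Digraph`, namespace `Literature.Combinatorics.Digraph.Multidigraph`.
Lane `lit-hodgefound`, seat p23, generation 46, row g46-#9 of the programme «The spectrum of the arc
digraph and de Bruijn's count `2^{2^{n−1}−n}`» (sequel of `LineDigraphLaplacianSpectrum`, whose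
unweighted statements are the case `x_e = 1`).

## Source, verbatim

L. Levine, *Sandpile groups and spanning trees of directed line graphs*, J. Combin. Theory Ser. A 118
(2011) 350–364 [Levine2011] (held text `paper:arxiv-0906.2809`, chunk p0003):
«Our first result relates the numbers `κ(LG)` and `κ(G)`. Let `{x_e}_{e ∈ E}` and `{x_v}_{v ∈ V}` be
indeterminates, and consider the polynomials `κ^{edge}(G, x) = Σ_T ∏_{e ∈ T} x_e`,
`κ^{vertex}(G, x) = Σ_T ∏_{e ∈ T} x_{t(e)}`. The sums are over all oriented spanning trees `T` of `G`.
[…] **Theorem 1.1.** Let `G = (V, E)` be a finite directed graph with no sources. Then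
`κ^{vertex}(LG, x) = κ^{edge}(G, x) ∏_{v ∈ V} (Σ_{s(e) = v} x_e)^{indeg(v) − 1}`. (1)
Note that since the vertex set of `LG` coincides with the edge set of `G`, both sides of (1) are
polynomials in the same set of variables `{x_e}_{e ∈ E}`. Setting all `x_e = 1` yields the product
formula `κ(LG) = κ(G) ∏_{v ∈ V} outdeg(v)^{indeg(v) − 1}` (2)».

## The proof formalised here

The spectral proof of `LineDigraphLaplacianSpectrum` run with weights: for arc weights `w : A → S` in
any commutative ring, the arc-weighted Laplace matrix is `L_w = diag(s) − Sᵀ·diag(w)·T` with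
`s_v = Σ_{src a = v} w_a`, its principal minors are the generating functions
`κ_s(G, w) = Σ_{T → s} ∏_{v ≠ s} w(T v)` of the arborescences converging to `s` (§1, the arc-weighted
matrix-tree theorem, through the tree's weighted matrix-forest theorem with the weights
`W(u, v) = Σ_{a : u → v} w_a` and the fibre decomposition of gen-45's `filter_arborescencesTo_parentMap_eq`);
the arc digraph with the head weights `w*(a, b) = w_b` has `L*_w = diag(s ∘ tgt) − T·Sᵀ·diag(w)`, so
the intertwined Sylvester identity gives `χ_{L*_w}·∏_v (X − s_v) = ∏_a (X − s_{tgt a})·χ_{L_w}` (§3) and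
the coefficients of `X` give (1) in the division-free form
`κ^{vertex}(G*, w)·∏_v s_v = ∏_v s_v^{indeg v}·κ^{edge}(G, w)` (§4).

## What is here (definitions with bodies, theorems; no named fact, no instance, no notation)

* §1 `arcWeight w u v = Σ_{a : u → v} w_a`, `outWeight w v = s_v`, `arborescencePolyTo w s = κ_s`,
  `arborescencePoly w = Σ_s κ_s` (`κ^{edge}(G, w)`; with `w = x ∘ tgt` on `G*` it is `κ^{vertex}`);
  **`arborescencePolyTo_eq_det`** — the arc-weighted matrix-tree theorem
  `κ_s(G, w) = det (L_w)_{s,s}`; `arborescencePolyTo_one` (all weights `1`: the count `t⁻(G, s)`).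
* §2 `charpoly_coeff_one_eq_sum_det` — for every square matrix,
  `χ_M.coeff 1 = (−1)^{N−1} Σ_i det M^{(i)}` (principal minors), and
  `charpoly_wLaplacian_arcWeight_coeff_one` — `χ_{L_w}.coeff 1 = (−1)^{N−1} κ^{edge}(G, w)`.
* §3 **`charpoly_wLaplacian_lineDigraph_mul`** —
  `χ_{L*_w}·∏_v (X − s_v) = ∏_a (X − s_{tgt a})·χ_{L_w}`.
* §4 **`arborescencePoly_lineDigraph_mul`** — Theorem 1.1, division-free, every commutative ring and
  every finite directed multigraph with an arc: `κ^{vertex}(G*, w)·∏_v s_v = (∏_v s_v^{indeg v})·κ^{edge}(G, w)`;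
  **`arborescencePoly_lineDigraph`** — Theorem 1.1 as printed over an integral domain, for `G` with no
  sources and all `s_v ≠ 0`; and **`arborescencePoly_lineDigraph_X`** — the printed statement with the
  indeterminates `x_e` (`MvPolynomial A ℤ`), for `G` without sources and sinks.

## References

* [Levine2011] L. Levine, *Sandpile groups and spanning trees of directed line graphs*, J. Combin.
  Theory Ser. A 118 (2011) 350–364, Theorem 1.1.
* [Knuth1967] D. E. Knuth, *Oriented subtrees of an arc digraph*, Theorem (5).
* Tree: `SimpleGraph/WeightedMatrixForestTheorem` (`det_wLaplacian_submatrix_compl_singleton`),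
  `Digraph/MultidigraphArborescences` (`filter_arborescencesTo_parentMap_eq`),
  `Digraph/LineDigraphLaplacianSpectrum` (`det_add_mul_mul_det_eq_of_mul_eq_mul`).
-/

namespace Literature.Combinatorics.Digraph

namespace Multidigraph

open Finset Matrix Polynomial
open Literature.Combinatorics.SimpleGraph.WeightedMatrixForest Literature.Combinatorics.Enumerative

variable {V A : Type*} (G : Multidigraph V A) {S : Type*} [CommRing S]

/-! ### §1 Arc weights, the weighted Laplace matrix and the arc-weighted matrix-tree theorem -/

section Weighted

variable [Fintype V] [DecidableEq V] [Fintype A]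

/-- The total weight `W(u, v) = Σ_{a : u → v} w_a` of the arcs from `u` to `v`. [cite: Levine2011,
§1 (the weights `x_e`)] -/
def arcWeight (w : A → S) (u v : V) : S := ∑ a ∈ G.arcsFromTo u v, w a

/-- The out-weight `s_v = Σ_{s(e) = v} x_e` of a vertex. [cite: Levine2011, Thm. 1.1 (the factor
`Σ_{s(e)=v} x_e`)] -/
def outWeight (w : A → S) (v : V) : S := ∑ a ∈ G.outArcs v, w a

/-- **`κ_s(G, w) = Σ_T ∏_{e ∈ T} w_e`** over the spanning arborescences `T` converging to `s` (an
arborescence is presented by its arcs `T v`, `v ≠ s`). [cite: Levine2011, §1 (`κ^{edge}(G, x)`,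
restricted to the trees with root `s`)] -/
noncomputable def arborescencePolyTo (w : A → S) (s : V) : S := ∑ T ∈ G.arborescencesTo s, ∏ v, w (T v)

/-- **`κ^{edge}(G, w) = Σ_T ∏_{e ∈ T} w_e`**, the sum over ALL oriented spanning trees (all roots).
With the head weights `w ∘ tgt` on the arc digraph this is `κ^{vertex}(LG, w)`.
[cite: Levine2011, §1 (definitions of `κ^{edge}`, `κ^{vertex}`)] -/
noncomputable def arborescencePoly (w : A → S) : S := ∑ s, G.arborescencePolyTo w s

variable {G}

omit [Fintype V] in
/-- [cite: Levine2011, §1] -/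
theorem arcWeight_def (w : A → S) (u v : V) : G.arcWeight w u v = ∑ a ∈ G.arcsFromTo u v, w a := rfl

omit [Fintype V] in
/-- [cite: Levine2011, §1] -/
theorem outWeight_def (w : A → S) (v : V) : G.outWeight w v = ∑ a ∈ G.outArcs v, w a := rfl

variable (G)

/-- `s_u = Σ_v W(u, v)`. [cite: Levine2011, §1] -/
theorem outWeight_eq_sum_arcWeight (w : A → S) (u : V) :
    G.outWeight w u = ∑ v, G.arcWeight w u v := by
  rw [outWeight, ← Finset.sum_fiberwise_of_maps_to (g := G.tgt) (t := (univ : Finset V))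
    (fun a _ => mem_univ _)]
  refine Finset.sum_congr rfl fun v _ => ?_
  rw [arcWeight]
  congr 1
  ext a
  simp [outArcs, arcsFromTo]

omit [Fintype V] in
/-- With all weights `1`, `W(u, v) = a_{uv}`. [cite: Levine2011, §1 («Setting all `x_e = 1`»)] -/
theorem arcWeight_one (u v : V) : G.arcWeight (fun _ => (1 : S)) u v = G.arcCount u v := by
  rw [arcWeight, Finset.sum_const, nsmul_eq_mul, mul_one]
  rfl

omit [Fintype V] in
/-- With all weights `1`, `s_v = outdeg(v)`. [cite: Levine2011, §1 («Setting all `x_e = 1`»)] -/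
theorem outWeight_one (v : V) : G.outWeight (fun _ => (1 : S)) v = G.outDeg v := by
  rw [outWeight, Finset.sum_const, nsmul_eq_mul, mul_one]
  rfl

/-- Diagonal entries of the arc-weighted Laplace matrix: `s_u − W(u, u)` (loops cancel).
[cite: Levine2011, §2 (the Laplacian `Δ = D − A`)] -/
theorem wLaplacian_arcWeight_apply_self (w : A → S) (u : V) :
    wLaplacian (G.arcWeight w) u u = G.outWeight w u - G.arcWeight w u u := by
  rw [wLaplacian_apply_self, G.outWeight_eq_sum_arcWeight w u, ← Finset.add_sum_erase _ _ (mem_univ u)]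
  ring

/-- Off-diagonal entries `−W(u, v)`. [cite: Levine2011, §2] -/
theorem wLaplacian_arcWeight_apply_of_ne (w : A → S) {u v : V} (h : u ≠ v) :
    wLaplacian (G.arcWeight w) u v = -G.arcWeight w u v :=
  wLaplacian_apply_of_ne _ h

/-- **`κ_s(G, w)` over the vertex-level forests**: `κ_s = Σ_τ ∏_{v ≠ s} W(v, τ v)`, summing over the
parent maps `τ` (the tree's `forests univ {s}`) and choosing one arc `v → τ v` in each fibre.
[cite: Levine2011, Thm. 1.1 (proof idea: expand the products); Knuth1967, p. 310 (Tutte's theorem)] -/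
theorem arborescencePolyTo_eq_sum_forests (w : A → S) (s : V) :
    G.arborescencePolyTo w s =
      ∑ τ ∈ forests (univ : Finset V) {s}, ∏ v ∈ univ.erase s, G.arcWeight w v (τ v) := by
  classical
  unfold arborescencePolyTo
  rw [← Finset.sum_fiberwise_of_maps_to (g := G.parentMap s) (t := forests (univ : Finset V) {s})
    (fun T hT => mem_forests.2 (mem_arborescencesTo.1 hT).isForestOn)]
  refine Finset.sum_congr rfl fun τ hτ => ?_
  rw [G.filter_arborescencesTo_parentMap_eq (mem_forests.1 hτ),
    ← Finset.prod_univ_sum (fun v : {v : V // v ≠ s} => G.arcsFromTo v (τ v)) (fun _ a => w a)]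
  exact (Finset.prod_subtype (univ.erase s) (fun v => by simp)
    (fun v => ∑ a ∈ G.arcsFromTo v (τ v), w a)).symm

/-- **The arc-weighted matrix-tree theorem**: `κ_s(G, w) = det (L_w)_{s,s}`, the principal minor of
the arc-weighted Laplace matrix on the vertices `≠ s` (the tree's weighted matrix-forest theorem
with the weights `W(u, v)`). [cite: Levine2011, §2 (matrix-tree theorem for `κ(G, v_*)`); Knuth1967,
p. 310] -/
theorem arborescencePolyTo_eq_det (w : A → S) (s : V) :
    G.arborescencePolyTo w s =
      ((wLaplacian (G.arcWeight w)).submatrix (Subtype.val : {v // v ≠ s} → V) Subtype.val).det := by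
  let e : {v // v ≠ s} ≃ ↥(({s} : Finset V)ᶜ) :=
    Equiv.subtypeEquivRight fun v => by rw [Finset.mem_compl, Finset.mem_singleton]
  have h : (wLaplacian (G.arcWeight w)).submatrix (Subtype.val : {v // v ≠ s} → V) Subtype.val =
      ((wLaplacian (G.arcWeight w)).submatrix (Subtype.val : ↥(({s} : Finset V)ᶜ) → V)
        Subtype.val).submatrix e e := by
    ext i j
    rfl
  rw [h, Matrix.det_submatrix_equiv_self, det_wLaplacian_submatrix_compl_singleton,
    arborescencePolyTo_eq_sum_forests]

/-- With all weights `1`, `κ_s` is the number `t⁻(G, s)` of arborescences. [cite: Levine2011, §1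
(«Setting all `x_e = 1`»)] -/
theorem arborescencePolyTo_one (s : V) :
    G.arborescencePolyTo (fun _ => (1 : S)) s = (G.arborescencesTo s).card := by
  rw [arborescencePolyTo]
  simp

/-- With all weights `1`, `κ^{edge}(G, 1) = κ(G) = Σ_s t⁻(G, s)`. [cite: Levine2011, §1, eq. (2)] -/
theorem arborescencePoly_one :
    G.arborescencePoly (fun _ => (1 : S)) = ((∑ s, (G.arborescencesTo s).card : ℕ) : S) := by
  rw [arborescencePoly, Nat.cast_sum]
  exact Finset.sum_congr rfl fun s _ => G.arborescencePolyTo_one s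

end Weighted

/-! ### §2 The coefficient of `X`: `χ_M.coeff 1 = (−1)^{N−1} Σ_i det M^{(i)}` -/

section Coefficient

/-- For every square matrix, **the coefficient of `X` in `χ_M` is `(−1)^{N−1}` times the sum of the
principal minors of order `N − 1`** (from `χ_M' = Σ_i χ_{M^{(i)}}` at `X = 0`).
[cite: Stanley2013AlgebraicCombinatorics, Lemma 9.9 (proof)] -/
theorem charpoly_coeff_one_eq_sum_det {ι : Type*} [Fintype ι] [DecidableEq ι] {R : Type*} [CommRing R]
    (M : Matrix ι ι R) :
    M.charpoly.coeff 1 =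
      (-1) ^ (Fintype.card ι - 1) * ∑ i, (M.submatrix (Subtype.val : {a // a ≠ i} → ι) Subtype.val).det := by
  have h' : M.charpoly.coeff 1 = (derivative M.charpoly).coeff 0 := by
    rw [Polynomial.coeff_derivative]; simp
  rw [h', Polynomial.coeff_zero_eq_eval_zero,
    Literature.Combinatorics.SimpleGraph.VertexDeletedCharpoly.eval_derivative_charpoly_eq_sum,
    Finset.mul_sum]
  refine Finset.sum_congr rfl fun i _ => ?_
  have hcard : Fintype.card {a // a ≠ i} = Fintype.card ι - 1 := by
    rw [Fintype.card_subtype_compl, Fintype.card_subtype_eq]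
  have h := Matrix.det_eq_sign_charpoly_coeff (M.submatrix (Subtype.val : {a // a ≠ i} → ι) Subtype.val)
  rw [hcard] at h
  rw [← Polynomial.coeff_zero_eq_eval_zero, h, ← mul_assoc, ← pow_add, ← two_mul, pow_mul, neg_one_sq,
    one_pow, one_mul]

variable [Fintype V] [DecidableEq V] [Fintype A]

/-- `χ_{L_w}.coeff 1 = (−1)^{N−1} · κ^{edge}(G, w)`. [cite: Levine2011, Thm. 1.1 (proof device);
Stanley2013AlgebraicCombinatorics, Lemma 9.9] -/
theorem charpoly_wLaplacian_arcWeight_coeff_one (w : A → S) :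
    (wLaplacian (G.arcWeight w)).charpoly.coeff 1 =
      (-1) ^ (Fintype.card V - 1) * G.arborescencePoly w := by
  rw [charpoly_coeff_one_eq_sum_det, arborescencePoly]
  congr 1
  exact Finset.sum_congr rfl fun s _ => (G.arborescencePolyTo_eq_det w s).symm

/-- `χ_{L_w}.coeff 0 = 0` (`det L_w = 0`: zero row sums). [cite: Stanley2013AlgebraicCombinatorics,
Lemma 9.9] -/
theorem charpoly_wLaplacian_arcWeight_coeff_zero [Nonempty V] (w : A → S) :
    (wLaplacian (G.arcWeight w)).charpoly.coeff 0 = 0 := by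
  have h := Matrix.det_eq_sign_charpoly_coeff (wLaplacian (G.arcWeight w))
  rw [det_wLaplacian] at h
  have hu : IsUnit ((-1 : S) ^ Fintype.card V) := (isUnit_one.neg).pow _
  exact (hu.mul_right_eq_zero).1 h.symm

end Coefficient

/-! ### §3 The arc digraph with head weights: `χ_{L*_w}·∏_v (X − s_v) = ∏_a (X − s_{tgt a})·χ_{L_w}` -/

section LineDigraph

variable [Fintype V] [DecidableEq V] [Fintype A] [DecidableEq A]

omit [Fintype V] in
/-- In the arc digraph with the head weights `w*(a → b) = w_b`: `W*(a, b) = [tgt a = src b] · w_b`.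
[cite: Levine2011, §1 (`κ^{vertex}`: the weight `x_{t(e)}`)] -/
theorem arcWeight_lineDigraph (w : A → S) (a b : A) :
    G.lineDigraph.arcWeight (fun p => w p.1.2) a b = if G.tgt a = G.src b then w b else 0 := by
  rw [arcWeight]
  split_ifs with h
  · have hset : G.lineDigraph.arcsFromTo a b = {⟨(a, b), h⟩} := by
      ext p
      simp only [mem_arcsFromTo, lineDigraph_src, lineDigraph_tgt, Finset.mem_singleton]
      constructor
      · rintro ⟨h₁, h₂⟩
        exact Subtype.ext (Prod.ext h₁ h₂)
      · rintro rfl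
        exact ⟨rfl, rfl⟩
    rw [hset, Finset.sum_singleton]
  · have hset : G.lineDigraph.arcsFromTo a b = ∅ := by
      rw [Finset.eq_empty_iff_forall_notMem]
      rintro p hp
      rw [mem_arcsFromTo, lineDigraph_src, lineDigraph_tgt] at hp
      apply h
      rw [← hp.1, ← hp.2]
      exact p.2
    rw [hset, Finset.sum_empty]

omit [Fintype V] in
/-- The out-weight of the arc `a` in the head-weighted arc digraph is `s_{tgt a}`.
[cite: Levine2011, Thm. 1.1] -/
theorem outWeight_lineDigraph (w : A → S) (a : A) :
    G.lineDigraph.outWeight (fun p => w p.1.2) a = G.outWeight w (G.tgt a) := by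
  rw [outWeight_eq_sum_arcWeight, outWeight]
  simp_rw [arcWeight_lineDigraph]
  rw [← Finset.sum_filter]
  congr 1
  ext b
  simp only [mem_filter, mem_univ, true_and, mem_outArcs]
  exact eq_comm

/-- **`χ_{L*_w}(X)·∏_v (X − s_v) = ∏_a (X − s_{tgt a})·χ_{L_w}(X)`** for the arc digraph with head
weights — every finite directed multigraph, every commutative ring of weights.
[cite: Levine2011, Thm. 1.1 (its characteristic-polynomial form)] -/
theorem charpoly_wLaplacian_lineDigraph_mul (w : A → S) :
    (wLaplacian (G.lineDigraph.arcWeight fun p => w p.1.2)).charpoly *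
        ∏ v, (X - C (G.outWeight w v)) =
      (∏ a, (X - C (G.outWeight w (G.tgt a)))) * (wLaplacian (G.arcWeight w)).charpoly := by
  set P : Matrix A V S[X] := G.tgtMatrix S[X] with hP
  set Q : Matrix V A S[X] := (G.srcMatrix S[X])ᵀ * diagonal fun a => C (w a) with hQ
  set D₁ : Matrix A A S[X] := diagonal fun a => X - C (G.outWeight w (G.tgt a)) with hD₁
  set D₂ : Matrix V V S[X] := diagonal fun v => X - C (G.outWeight w v) with hD₂
  have hcomm : D₁ * P = P * D₂ := by
    rw [hP, hD₁, hD₂, G.tgtMatrix_mul_diagonal]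
  -- `(PQ)_{ab} = C([tgt a = src b] w_b)`, `(QP)_{uv} = C(W(u, v))`
  have hPQ : ∀ a b, (P * Q) a b = C (G.lineDigraph.arcWeight (fun p => w p.1.2) a b) := by
    intro a b
    rw [hP, hQ, ← Matrix.mul_assoc, ← adjMatrix_lineDigraph, mul_diagonal, adjMatrix_lineDigraph_apply,
      arcWeight_lineDigraph]
    split_ifs <;> simp
  have hQP : ∀ u v, (Q * P) u v = C (G.arcWeight w u v) := by
    intro u v
    rw [hP, hQ, mul_apply, arcWeight, arcsFromTo, Finset.sum_filter, map_sum]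
    refine Finset.sum_congr rfl fun a _ => ?_
    rw [mul_diagonal, transpose_apply, srcMatrix_apply, tgtMatrix_apply]
    by_cases h₁ : G.src a = u <;> by_cases h₂ : G.tgt a = v <;> simp [h₁, h₂]
  have h1 : charmatrix (wLaplacian (G.lineDigraph.arcWeight fun p => w p.1.2)) = D₁ + P * Q := by
    refine Matrix.ext fun a b => ?_
    rw [charmatrix_apply, Matrix.add_apply, hPQ, hD₁, diagonal_apply, diagonal_apply]
    by_cases hab : a = b
    · subst hab
      rw [if_pos rfl, if_pos rfl, wLaplacian_arcWeight_apply_self, outWeight_lineDigraph, map_sub]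
      ring
    · rw [if_neg hab, if_neg hab, G.lineDigraph.wLaplacian_arcWeight_apply_of_ne _ hab, map_neg]
      ring
  have h2 : charmatrix (wLaplacian (G.arcWeight w)) = D₂ + Q * P := by
    refine Matrix.ext fun u v => ?_
    rw [charmatrix_apply, Matrix.add_apply, hQP, hD₂, diagonal_apply, diagonal_apply]
    by_cases huv : u = v
    · subst huv
      rw [if_pos rfl, if_pos rfl, wLaplacian_arcWeight_apply_self, map_sub]
      ring
    · rw [if_neg huv, if_neg huv, G.wLaplacian_arcWeight_apply_of_ne _ huv, map_neg]
      ring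
  have hdet₁ : D₁.det = ∏ a, (X - C (G.outWeight w (G.tgt a))) := by rw [hD₁, det_diagonal]
  have hdet₂ : D₂.det = ∏ v, (X - C (G.outWeight w v)) := by rw [hD₂, det_diagonal]
  have key := det_add_mul_mul_det_eq_of_mul_eq_mul D₁ D₂ P Q hcomm
  rw [← h1, ← h2, hdet₁, hdet₂] at key
  exact key

end LineDigraph

/-! ### §4 Theorem 1.1 -/

section Theorem

variable [Fintype V] [DecidableEq V] [Fintype A] [DecidableEq A]

omit [DecidableEq A] in
/-- `∏_a s_{tgt a} = ∏_v s_v^{indeg v}`. [cite: Levine2011, Thm. 1.1] -/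
theorem prod_outWeight_tgt (w : A → S) :
    ∏ a, G.outWeight w (G.tgt a) = ∏ v, G.outWeight w v ^ G.inDeg v := by
  rw [← Finset.prod_fiberwise_of_maps_to (g := G.tgt) (t := (univ : Finset V)) (fun a _ => mem_univ _)]
  refine Finset.prod_congr rfl fun v _ => ?_
  rw [Finset.prod_congr rfl fun a (ha : a ∈ univ.filter fun a => G.tgt a = v) => by
    rw [(Finset.mem_filter.1 ha).2], Finset.prod_const]
  rfl

/-- **Theorem 1.1, division-free, for every finite directed multigraph with an arc and every
commutative ring of weights**: `κ^{vertex}(G*, w) · ∏_v s_v = (∏_v s_v^{indeg v}) · κ^{edge}(G, w)`,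
where `κ^{vertex}(G*, w) = Σ_{T* tree of G*} ∏ w_{head}` and `s_v = Σ_{src a = v} w_a`.
[cite: Levine2011, Thm. 1.1] -/
theorem arborescencePoly_lineDigraph_mul [Nonempty A] (w : A → S) :
    G.lineDigraph.arborescencePoly (fun p => w p.1.2) * ∏ v, G.outWeight w v =
      (∏ v, G.outWeight w v ^ G.inDeg v) * G.arborescencePoly w := by
  classical
  obtain ⟨a₀⟩ := (inferInstance : Nonempty A)
  haveI : Nonempty V := ⟨G.src a₀⟩
  have key := congrArg (fun p : S[X] => p.coeff 1) (G.charpoly_wLaplacian_lineDigraph_mul w)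
  rw [coeff_one_mul_of_coeff_zero_eq_zero _ _ (G.lineDigraph.charpoly_wLaplacian_arcWeight_coeff_zero _),
    mul_comm (∏ a, (X - C (G.outWeight w (G.tgt a)))) _,
    coeff_one_mul_of_coeff_zero_eq_zero _ _ (G.charpoly_wLaplacian_arcWeight_coeff_zero w),
    coeff_zero_prod_X_sub_C, coeff_zero_prod_X_sub_C, charpoly_wLaplacian_arcWeight_coeff_one,
    charpoly_wLaplacian_arcWeight_coeff_one, prod_outWeight_tgt] at key
  obtain ⟨n, hn⟩ : ∃ n, Fintype.card V = n + 1 := Nat.exists_eq_succ_of_ne_zero Fintype.card_ne_zero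
  obtain ⟨m, hm⟩ : ∃ m, Fintype.card A = m + 1 := Nat.exists_eq_succ_of_ne_zero Fintype.card_ne_zero
  rw [hn, hm, Nat.add_sub_cancel, Nat.add_sub_cancel] at key
  have hu : IsUnit ((-1 : S) ^ m * (-1) ^ n) := ((isUnit_one.neg).pow _).mul ((isUnit_one.neg).pow _)
  have key' : ((-1 : S) ^ m * (-1) ^ n) *
      (G.lineDigraph.arborescencePoly (fun p => w p.1.2) * ∏ v, G.outWeight w v) =
      ((-1 : S) ^ m * (-1) ^ n) * ((∏ v, G.outWeight w v ^ G.inDeg v) * G.arborescencePoly w) := by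
    linear_combination (-1 : S) * key
  exact hu.mul_right_injective key'

/-- **Theorem 1.1** («Let `G = (V, E)` be a finite directed graph with no sources. Then
`κ^{vertex}(LG, x) = κ^{edge}(G, x) ∏_{v ∈ V} (Σ_{s(e)=v} x_e)^{indeg(v) − 1}`») — over an integral
domain of weights, for `G` without sources and with all out-weights `s_v ≠ 0` (in the printed setting
of indeterminates: no sinks). [cite: Levine2011, Thm. 1.1] -/
theorem arborescencePoly_lineDigraph [IsDomain S] (w : A → S) (hin : ∀ v, 0 < G.inDeg v)
    (hout : ∀ v, G.outWeight w v ≠ 0) :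
    G.lineDigraph.arborescencePoly (fun p => w p.1.2) =
      G.arborescencePoly w * ∏ v, G.outWeight w v ^ (G.inDeg v - 1) := by
  classical
  cases isEmpty_or_nonempty V with
  | inl h =>
    haveI : IsEmpty A := ⟨fun a => h.false (G.src a)⟩
    simp [arborescencePoly]
  | inr h =>
    obtain ⟨v₀⟩ := h
    obtain ⟨a₀, ha₀⟩ : ∃ a, G.tgt a = v₀ := by
      have := hin v₀
      rw [inDeg, Finset.card_pos] at this
      obtain ⟨a, ha⟩ := this
      exact ⟨a, mem_inArcs.1 ha⟩
    haveI : Nonempty A := ⟨a₀⟩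
    have key := G.arborescencePoly_lineDigraph_mul w
    have hsplit : ∏ v, G.outWeight w v ^ G.inDeg v =
        (∏ v, G.outWeight w v ^ (G.inDeg v - 1)) * ∏ v, G.outWeight w v := by
      rw [← Finset.prod_mul_distrib]
      refine Finset.prod_congr rfl fun v _ => ?_
      rw [← pow_succ, Nat.sub_add_cancel (hin v)]
    rw [hsplit, mul_assoc, mul_comm (∏ v, G.outWeight w v) _, ← mul_assoc] at key
    have hne : ∏ v, G.outWeight w v ≠ 0 := Finset.prod_ne_zero_iff.2 fun v _ => hout v
    have := mul_right_cancel₀ hne key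
    rw [this, mul_comm]

omit [Fintype V] [DecidableEq V] [Fintype A] [DecidableEq A] in
/-- A sum of distinct indeterminates is nonzero. [cite: Levine2011, Thm. 1.1 («indeterminates»)] -/
theorem sum_X_ne_zero {s : Finset A} (hs : s.Nonempty) :
    ∑ a ∈ s, (MvPolynomial.X a : MvPolynomial A ℤ) ≠ 0 := by
  intro h
  have h' := congrArg (MvPolynomial.eval fun _ => (1 : ℤ)) h
  rw [map_sum, map_zero] at h'
  simp only [MvPolynomial.eval_X, Finset.sum_const, nsmul_eq_mul, mul_one] at h'
  exact hs.card_pos.ne' (by exact_mod_cast h')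

/-- **Theorem 1.1 as printed, with the indeterminates `x_e`** (`MvPolynomial A ℤ`): for a finite
directed multigraph with no sources and no sinks,
`κ^{vertex}(LG, x) = κ^{edge}(G, x) · ∏_v (Σ_{s(e) = v} x_e)^{indeg(v) − 1}`. [cite: Levine2011,
Thm. 1.1] -/
theorem arborescencePoly_lineDigraph_X (hin : ∀ v, 0 < G.inDeg v) (hout : ∀ v, 0 < G.outDeg v) :
    G.lineDigraph.arborescencePoly (fun p => (MvPolynomial.X p.1.2 : MvPolynomial A ℤ)) =
      G.arborescencePoly (fun a => MvPolynomial.X a) *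
        ∏ v, (∑ a ∈ G.outArcs v, (MvPolynomial.X a : MvPolynomial A ℤ)) ^ (G.inDeg v - 1) := by
  have h := G.arborescencePoly_lineDigraph (S := MvPolynomial A ℤ) (fun a => MvPolynomial.X a) hin
    (fun v => by
      rw [outWeight]
      exact sum_X_ne_zero (by
        rw [Finset.nonempty_iff_ne_empty, Ne, ← Finset.card_eq_zero]
        exact (hout v).ne'))
  rw [h]
  rfl

/-- «Setting all `x_e = 1` yields the product formula (2)» — the specialisation recovers the
unweighted `κ(G*)·∏σ_v = ∏σ_v^{indeg v}·κ(G)` of `LineDigraphLaplacianSpectrum`.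
[cite: Levine2011, eq. (2)] -/
theorem arborescencePoly_lineDigraph_mul_one [Nonempty A] :
    ((∑ a, (G.lineDigraph.arborescencesTo a).card : ℕ) : S) * ∏ v, (G.outDeg v : S) =
      (∏ v, (G.outDeg v : S) ^ G.inDeg v) * ((∑ v, (G.arborescencesTo v).card : ℕ) : S) := by
  have h := G.arborescencePoly_lineDigraph_mul (fun _ => (1 : S))
  rw [arborescencePoly_one, arborescencePoly_one] at h
  simp_rw [outWeight_one] at h
  exact h

end Theorem

end Multidigraph

end Literature.Combinatorics.Digraph
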